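import Summits.CriticalPhenomena.PercolationContinuityZ3.Theorems.PercNearOneGluingNoHeavyLowerTailSahiCTCLadderThreeReduction
import Summits.CriticalPhenomena.PercolationContinuityZ3.Theorems.PercNearOneGluingNoHeavyLowerTailSahiCTCLadderThreeRowFour
import Summits.CriticalPhenomena.PercolationContinuityZ3.Theorems.PercNearOneGluingNoHeavyLowerTailSahiCTCLadderThreeRowThreeZeroMain
import HarnessLib

/-!
# `NoHeavyLowerTail` (crux stmt-CriticalPhenomena-4575), P3 lane: status of the level-3 ladder `(L_3)` after gen 26

Support file (seat `prim-l12-p3`, gen 26; `--supports stmt-CriticalPhenomena-4575`).  One consolidating theorem: for 3-live up-sets `𝒳, 𝒵`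
the coefficient of the ladder form `L_3 = e_3·(Π·GF(𝒳∩𝒵) − GF(𝒳)GF(𝒵)) − Θ_2·e_{≥3}·GF((𝒳∩𝒵)_3)` at a profile `m` is nonnegative
whenever `m` is not in one of the two open rows (`#dbl m ∈ {1,2}`) and is not one of the finitely many small profiles of the rows 3 and 4
(`#dbl m = 3` needs `#(lev m 1) ≥ 18`, `#dbl m = 4` needs `#(lev m 1) ≥ 2`): it combines `coeff_ladder_three_nonneg_of_not_Drow`
(exponent ≥ 3, no doubled point, ≥ 5 doubled points), `coeff_ladder_three_rowFour_nonneg` and `coeff_ladder_three_rowThree_nonneg`.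
Nothing is asserted about the crux.
-/

namespace Summit.CriticalPhenomena.PercolationContinuityZ3.Theorems.SahiCTCForms

open Finset MvPolynomial SahiCTCGenFun SahiCTCWeightedLYM

variable {α : Type*} [DecidableEq α] [Fintype α]

/-- **`(L_3)` outside the open rows**: for 3-live up-sets and a profile `m` with (an exponent ≥ 3) or `#dbl m ∉ {1, 2}`, and with
`τ = #(lev m 1) ≥ 18` when `#dbl m = 3` resp. `τ ≥ 2` when `#dbl m = 4`, the `m`-coefficient of `L_3` is ≥ 0. [this work] -/
theorem coeff_ladder_three_nonneg_of_settled_row {𝒳 𝒵 : Finset (Finset α)} (h𝒳 : IsUpperSet (𝒳 : Set (Finset α)))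
    (h𝒵 : IsUpperSet (𝒵 : Set (Finset α))) (hX3 : ∀ S ∈ 𝒳, 3 ≤ #S) (hZ3 : ∀ S ∈ 𝒵, 3 ≤ #S) (m : α →₀ ℕ)
    (hrow : (∃ i, 3 ≤ m i) ∨ (#(dbl m) ≠ 1 ∧ #(dbl m) ≠ 2))
    (h3 : (∀ i, m i ≤ 2) → #(dbl m) = 3 → 18 ≤ #(lev m 1)) (h4 : (∀ i, m i ≤ 2) → #(dbl m) = 4 → 2 ≤ #(lev m 1)) :
    0 ≤ (ee 3 * (PiP * gf (𝒳 ∩ 𝒵) - gf 𝒳 * gf 𝒵) -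
      gf (bySize (· ≤ 3 - 1) : Finset (Finset α)) * gf (bySize (3 ≤ ·) : Finset (Finset α)) *
        gf ((𝒳 ∩ 𝒵).filter fun S => #S = 3)).coeff m := by
  by_cases hbig : ∃ i, 3 ≤ m i
  · exact coeff_ladder_three_nonneg_of_not_Drow h𝒳 h𝒵 hX3 hZ3 m (Or.inl hbig)
  have hm : ∀ i, m i ≤ 2 := fun i => by by_contra h; exact hbig ⟨i, by omega⟩
  rcases hrow with hbig' | ⟨h1, h2⟩
  · exact absurd hbig' hbig
  by_cases hD3 : #(dbl m) = 3
  · exact coeff_ladder_three_rowThree_nonneg h𝒳 h𝒵 hX3 hZ3 hm hD3 (h3 hm hD3)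
  by_cases hD4 : #(dbl m) = 4
  · exact coeff_ladder_three_rowFour_nonneg h𝒳 h𝒵 hX3 hZ3 hm hD4 (h4 hm hD4)
  exact coeff_ladder_three_nonneg_of_not_Drow h𝒳 h𝒵 hX3 hZ3 m (Or.inr (by omega))

end Summit.CriticalPhenomena.PercolationContinuityZ3.Theorems.SahiCTCForms
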